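import Literature.Probability.LatticeModels.LatticeGreenHeatKernel
import Literature.Probability.LatticeModels.LatticeGreenOriginBound
import Literature.Probability.LatticeModels.SRWReturnFourier
import Mathlib.MeasureTheory.Integral.IntervalIntegral.Periodic
import Mathlib.MeasureTheory.Integral.IntegralEqImproper
import HarnessLib

/-!
# The lattice Green function at the origin as the series of return probabilities, with an
# explicit remainder (Salmhofer–Seiler, CMP 139 (1991), Appendix: the road to Prop. 4.2 (4))

Topic `Probability/LatticeModels`; companion of `LatticeGreenFunction.lean` (`latticeGreen`),
`LatticeGreenHeatKernel.lean` ((A.7): `latticeGreen 0 = ∫₀^∞ r(t)^d dt`, `r(t) = q_t(0) = e^{-t}I₀(t)`),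
`LatticeGreenOriginBound.lean` (Lemma A.4: `r(t) ≤ (1+2t)^{-1/2}`) and `SRWReturnFourier.lean`
(`SRW.prob d n 0 = (2π)^{-d} ∫_{[-π,π]^d} φ(p)^n dp`, `φ(p) = d⁻¹ Σⱼ cos pⱼ`).  Theorems only.

Salmhofer–Seiler's Prop. 4.2 (4) and the remark (A.60) (p. 430) rest on computer-assisted values
of the constant `R(ν) = latticeGreen 0` ("`R(4) ≤ 0.3100`", …; "majorize [the integrand of (A.7)]
by a piecewise linear map … and thus get arbitrarily accurate upper bounds for `R(ν)`").  This file
supplies the ANALYTIC frame of a kernel-checkable replacement of that computation (carried out for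
`d = 4` in `LatticeGreenFourCertificate.lean`): writing `1/ε = d⁻¹ (1 - φ)⁻¹` and expanding the
geometric series to a FINITE order `K`,

* `dim_mul_latticeGreen_zero_eq_sum_add` — **`d · latticeGreen 0 = Σ_{n<K} P(Sₙ = 0) + Rem_K`**,
  `Rem_K = (2π)^{-d} ∫ φ^K d/ε` (every `K`, `d ≥ 3`);
* `setIntegral_exp_mul_inv_dispersion_eq` — the time-shifted heat-kernel representation
  `(2π)^{-d} ∫ e^{-Tε(p)}/ε(p) dp = ∫_T^∞ r(t)^d dt` (`T ≥ 0`; Fubini, as for (A.7));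
* `setIntegral_exp_neg_mul_sum_one_add_cos` — the antipodal Laplace transform
  `∫ e^{-a Σⱼ(1 + cos pⱼ)} dp = (2π)^d r(a)^d` (shift `pⱼ ↦ pⱼ + π` in each coordinate);
* `pow_mul_inv_one_sub_le` — the pointwise inequality
  `x^K/(1-x) ≤ e^{-K(1-x)}/(1-x) + e^{-K(1+x)}` for `x < 1` (`x ≤ e^{x-1}`), whence
* `remainder_le` / `neg_le_remainder` — **`-r(K/d)^d ≤ Rem_K ≤ d ∫_{K/d}^∞ r(t)^d dt + r(K/d)^d`**,
  packaged as `sum_range_prob_zero_mem_Icc` (two-sided control of `Σ_{n<K} P(Sₙ = 0)`);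
* `hasSum_prob_zero` — **`Σₙ P(Sₙ = 0) = d · latticeGreen 0`** (`d ≥ 3`), and the glue
  `SRW.green4_eq_four_mul_latticeGreen : green4 = 4 · latticeGreen 0` announced as deferred in the
  docstring of `SRW.green4` (`SRWReturnFourier.lean`).

With a sharpening `r(t) ≤ 0.43 t^{-1/2}` (`t ≥ 21`) of Lemma A.4 and the exact rational values of
`P(Sₙ = 0)`, `n < 84`, the remainder bound yields `4 R(4) < 5/4` by kernel evaluation (certificate
file).  Honest framing: pure analysis of the simple random walk / the free lattice field; no
statement about any spin system or gauge theory is made here.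

## References

* M. Salmhofer, E. Seiler, Commun. Math. Phys. 139 (1991) 395–432, Appendix (A.4), (A.7), Lemma A.4,
  Prop. 4.2 (4), (A.60) p. 430. [SalmhoferSeiler1991]
* G. F. Lawler, V. Limic, *Random Walk: A Modern Introduction*, CUP 2010, §4.3 (Green function =
  expected number of visits = `Σₙ pₙ(0)`). [LawlerLimic2010]
-/

noncomputable section

open MeasureTheory Set Filter Finset Real
open scoped Topology BigOperators

namespace Literature.Probability.LatticeModels

variable {d : ℕ}

/-! ### The symbol `φ(p) = d⁻¹ Σⱼ cos pⱼ` of the simple random walk (written out) -/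

/- Throughout, the symbol (characteristic function of one step) of the simple random walk on `ℤ^d`
is written out as `φ(p) = d⁻¹ Σⱼ cos pⱼ = (d : ℝ)⁻¹ * ∑ j, Real.cos (p j)` (the integrand of
`SRW.prob_eq_integral`); `ε(p) = d (1 - φ(p))`. -/

/-- `1 - φ(p) = ε(p)/d` (`d ≥ 1`). [folklore] -/
private theorem one_sub_inv_mul_sum_cos (hd : 0 < d) (p : Fin d → ℝ) :
    1 - (d : ℝ)⁻¹ * ∑ j, Real.cos (p j) = dispersion p / d := by
  have hd' : (d : ℝ) ≠ 0 := by exact_mod_cast hd.ne'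
  unfold dispersion
  rw [Finset.sum_sub_distrib, Finset.sum_const, Finset.card_univ, Fintype.card_fin, nsmul_eq_mul,
    mul_one]
  field_simp

/-- `1 + φ(p) = d⁻¹ Σⱼ (1 + cos pⱼ)` (`d ≥ 1`). [folklore] -/
private theorem one_add_inv_mul_sum_cos (hd : 0 < d) (p : Fin d → ℝ) :
    1 + (d : ℝ)⁻¹ * ∑ j, Real.cos (p j) = (d : ℝ)⁻¹ * ∑ j, (1 + Real.cos (p j)) := by
  have hd' : (d : ℝ) ≠ 0 := by exact_mod_cast hd.ne'
  rw [Finset.sum_add_distrib, Finset.sum_const, Finset.card_univ, Fintype.card_fin, nsmul_eq_mul,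
    mul_one]
  field_simp

/-- `|φ(p)| ≤ 1`. [folklore] -/
private theorem abs_inv_mul_sum_cos_le_one (p : Fin d → ℝ) : |(d : ℝ)⁻¹ * ∑ j, Real.cos (p j)| ≤ 1 := by
  rcases Nat.eq_zero_or_pos d with rfl | hd
  · simp
  have hd' : (0 : ℝ) < d := by exact_mod_cast hd
  rw [abs_mul, abs_inv, abs_of_pos hd', inv_mul_le_iff₀ hd', mul_one]
  calc |∑ j, Real.cos (p j)| ≤ ∑ j, |Real.cos (p j)| := Finset.abs_sum_le_sum_abs _ _
    _ ≤ ∑ _j : Fin d, (1 : ℝ) := Finset.sum_le_sum fun j _ => Real.abs_cos_le_one _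
    _ = d := by simp

/-- `φ` is continuous. [folklore] -/
private theorem continuous_inv_mul_sum_cos :
    Continuous (fun p : Fin d → ℝ => (d : ℝ)⁻¹ * ∑ j, Real.cos (p j)) := by
  fun_prop

/-- `ε > 0` almost everywhere on the Brillouin zone (it vanishes only at `p = 0`). [folklore] -/
private theorem ae_dispersion_pos (hd : 0 < d) :
    ∀ᵐ p ∂(volume.restrict (brillouin d)), 0 < dispersion p := by
  haveI : Nonempty (Fin d) := ⟨⟨0, hd⟩⟩
  have h_ne : ∀ᵐ p ∂(volume.restrict (brillouin d)), p ≠ (0 : Fin d → ℝ) := by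
    have h0 : (volume.restrict (brillouin d)) {(0 : Fin d → ℝ)} = 0 := by
      rw [Measure.restrict_apply (measurableSet_singleton 0)]
      exact measure_mono_null Set.inter_subset_left (measure_singleton 0)
    filter_upwards [measure_eq_zero_iff_ae_notMem.1 h0] with p hp
    simpa using hp
  filter_upwards [ae_restrict_mem (measurableSet_brillouin d), h_ne] with p hp hp0
  exact dispersion_pos_of_mem_brillouin hp hp0

/-! ### The finite geometric expansion of `1/ε` -/

/-- `(1 - x)⁻¹ = Σ_{n<K} xⁿ + x^K (1 - x)⁻¹` for `x ≠ 1`. [folklore] -/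
private theorem inv_one_sub_eq_geom_sum_add {x : ℝ} (hx : x ≠ 1) (K : ℕ) :
    (1 - x)⁻¹ = ∑ n ∈ Finset.range K, x ^ n + x ^ K * (1 - x)⁻¹ := by
  have h1 : (1 - x) ≠ 0 := sub_ne_zero.2 (Ne.symm hx)
  have hgeom := geom_sum_mul x K
  have hS : ∑ n ∈ Finset.range K, x ^ n = (1 - x ^ K) * (1 - x)⁻¹ := by
    rw [eq_mul_inv_iff_mul_eq₀ h1]
    linear_combination -hgeom
  rw [hS]
  ring

/-- Pointwise: `d/ε(p) = Σ_{n<K} φ(p)ⁿ + φ(p)^K · d/ε(p)` wherever `ε(p) ≠ 0`. [folklore] -/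
private theorem dim_div_dispersion_eq_sum_add (hd : 0 < d) {p : Fin d → ℝ} (hp : 0 < dispersion p) (K : ℕ) :
    (d : ℝ) / dispersion p =
      ∑ n ∈ Finset.range K, ((d : ℝ)⁻¹ * ∑ j, Real.cos (p j)) ^ n + ((d : ℝ)⁻¹ * ∑ j, Real.cos (p j)) ^ K * ((d : ℝ) / dispersion p) := by
  have hd' : (0 : ℝ) < d := by exact_mod_cast hd
  have h1 : (d : ℝ) / dispersion p = (1 - (d : ℝ)⁻¹ * ∑ j, Real.cos (p j))⁻¹ := by
    rw [one_sub_inv_mul_sum_cos hd, inv_div]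
  have hne : (d : ℝ)⁻¹ * ∑ j, Real.cos (p j) ≠ 1 := by
    intro h
    have := one_sub_inv_mul_sum_cos hd p
    rw [h, sub_self] at this
    have : dispersion p = 0 := by
      field_simp at this
      linarith
    exact hp.ne' this
  rw [h1]
  exact inv_one_sub_eq_geom_sum_add hne K

/-- `latticeGreen 0 = (2π)^{-d} ∫ dp/ε(p)`. [folklore] -/
private theorem latticeGreen_zero_eq_integral_inv :
    latticeGreen (0 : Site d) = (∫ p in brillouin d, 1 / dispersion p) / (2 * π) ^ d := by
  unfold latticeGreen
  simp

/-- The remainder integrand `φ^K · d/ε` is integrable on the Brillouin zone (`d ≥ 3`). [folklore] -/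
private theorem integrableOn_symbolPow_mul_dim_div_dispersion (hd : 3 ≤ d) (K : ℕ) :
    IntegrableOn (fun p : Fin d → ℝ => ((d : ℝ)⁻¹ * ∑ j, Real.cos (p j)) ^ K * ((d : ℝ) / dispersion p)) (brillouin d) := by
  have hinv : IntegrableOn (fun p : Fin d → ℝ => (d : ℝ) / dispersion p) (brillouin d) := by
    have h := (integrable_indicator_iff (measurableSet_brillouin d)).1
      (integrable_indicator_inv_dispersion d hd)
    refine (h.const_mul (d : ℝ)).congr (Eventually.of_forall fun p => ?_)
    exact (div_eq_mul_one_div _ _).symm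
  refine hinv.bdd_mul (c := 1) (((continuous_inv_mul_sum_cos (d := d)).pow K).aestronglyMeasurable)
    (Eventually.of_forall fun p => ?_)
  rw [norm_pow, Real.norm_eq_abs]
  exact pow_le_one₀ (abs_nonneg _) (abs_inv_mul_sum_cos_le_one p)

/-- **The lattice Green function at the origin, expanded to finite order in the return
probabilities**: for `d ≥ 3` and every `K`,
`d · latticeGreen 0 = Σ_{n<K} P(Sₙ = 0) + (2π)^{-d} ∫_{[-π,π]^d} φ^K d/ε`
(`1/ε = d⁻¹(1-φ)⁻¹` and the finite geometric series; `P(Sₙ = 0) = (2π)^{-d}∫φⁿ` is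
`SRW.prob_eq_integral`).  This is the frame in which Salmhofer–Seiler's computer-assisted values of
`R(ν) = latticeGreen 0` (Prop. 4.2 (4); p. 430) become kernel-checkable. [cite: SalmhoferSeiler1991, Appendix (A.4), (A.7) and p. 430] -/
theorem dim_mul_latticeGreen_zero_eq_sum_add (hd : 3 ≤ d) (K : ℕ) :
    (d : ℝ) * latticeGreen (0 : Site d) =
      ∑ n ∈ Finset.range K, SRW.prob d n 0 +
        ((2 * π) ^ d)⁻¹ * ∫ p in brillouin d, ((d : ℝ)⁻¹ * ∑ j, Real.cos (p j)) ^ K * ((d : ℝ) / dispersion p) := by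
  have hd0 : 0 < d := by omega
  have h2π : (0 : ℝ) < (2 * π) ^ d := by positivity
  -- integrability of the pieces
  have hinv : IntegrableOn (fun p : Fin d → ℝ => (d : ℝ) / dispersion p) (brillouin d) := by
    have h := (integrable_indicator_iff (measurableSet_brillouin d)).1
      (integrable_indicator_inv_dispersion d hd)
    refine (h.const_mul (d : ℝ)).congr (Eventually.of_forall fun p => ?_)
    exact (div_eq_mul_one_div _ _).symm
  have hpow : ∀ n : ℕ, IntegrableOn (fun p : Fin d → ℝ => ((d : ℝ)⁻¹ * ∑ j, Real.cos (p j)) ^ n) (brillouin d) := fun n =>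
    ((continuous_inv_mul_sum_cos (d := d)).pow n).continuousOn.integrableOn_compact (isCompact_brillouin d)
  have hrem := integrableOn_symbolPow_mul_dim_div_dispersion hd K
  -- `d · G(0) = (2π)^{-d} ∫ d/ε`
  have hG : (d : ℝ) * latticeGreen (0 : Site d) =
      ((2 * π) ^ d)⁻¹ * ∫ p in brillouin d, (d : ℝ) / dispersion p := by
    rw [latticeGreen_zero_eq_integral_inv]
    have h1 : ∫ p in brillouin d, (d : ℝ) / dispersion p = (d : ℝ) * ∫ p in brillouin d, 1 / dispersion p := by
      rw [← integral_const_mul]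
      refine integral_congr_ae (Eventually.of_forall fun p => ?_)
      exact div_eq_mul_one_div _ _
    rw [h1]
    field_simp
  -- the pointwise expansion, almost everywhere
  have hae : (fun p : Fin d → ℝ => (d : ℝ) / dispersion p) =ᵐ[volume.restrict (brillouin d)]
      fun p => ∑ n ∈ Finset.range K, ((d : ℝ)⁻¹ * ∑ j, Real.cos (p j)) ^ n +
        ((d : ℝ)⁻¹ * ∑ j, Real.cos (p j)) ^ K * ((d : ℝ) / dispersion p) := by
    filter_upwards [ae_dispersion_pos hd0] with p hp
    exact dim_div_dispersion_eq_sum_add hd0 hp K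
  rw [hG, integral_congr_ae hae, integral_add (integrable_finsetSum _ fun n _ => hpow n) hrem,
    integral_finsetSum _ fun n _ => hpow n, mul_add, Finset.mul_sum]
  congr 1
  refine Finset.sum_congr rfl fun n _ => ?_
  rw [SRW.prob_eq_integral hd0]

/-! ### The heat kernel of `ε` at the origin and the time-shifted representation -/

/-- `∫_{[-π,π]^d} e^{-tε(p)} dp = (2π)^d r(t)^d`, `r(t) = q_t(0)`: the integrand identity of
(A.7), "`∫ d^νk e^{-tD(k)}/(2π)^ν = r(t)^ν`" (the product structure `setIntegral_cos_mul_exp_eq_prod`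
at `x = 0`). [cite: SalmhoferSeiler1991, Appendix (A.7)] -/
theorem setIntegral_exp_neg_mul_dispersion (t : ℝ) :
    ∫ p in brillouin d, Real.exp (-(t * dispersion p)) = (2 * π) ^ d * srwHeatKernel t 0 ^ d := by
  have h := setIntegral_cos_mul_exp_eq_prod (d := d) t 0
  simp only [Pi.zero_apply, Int.cast_zero, mul_zero, Finset.sum_const_zero, Real.cos_zero, one_mul,
    Finset.prod_const, Finset.card_univ, Fintype.card_fin] at h
  exact h

/-- `∫_T^∞ e^{-tw} dt = e^{-Tw}/w` for `w > 0`, with integrability. [folklore] -/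
private theorem integral_exp_neg_mul_Ioi_of_pos {w : ℝ} (hw : 0 < w) (T : ℝ) :
    IntegrableOn (fun t : ℝ => Real.exp (-(t * w))) (Set.Ioi T) ∧
      ∫ t in Set.Ioi T, Real.exp (-(t * w)) = Real.exp (-(T * w)) / w := by
  have he : (fun t : ℝ => Real.exp (-(t * w))) = fun t => Real.exp (-w * t) := by
    funext t; ring_nf
  rw [he]
  refine ⟨exp_neg_integrableOn_Ioi T hw, ?_⟩
  rw [integral_exp_mul_Ioi (by linarith : -w < 0)]
  rw [show -w * T = -(T * w) by ring]
  field_simp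

/-- **Time-shifted heat-kernel representation** (`d ≥ 3`, `T ≥ 0`):
`(2π)^{-d} ∫_{[-π,π]^d} e^{-Tε(p)}/ε(p) dp = ∫_T^∞ r(t)^d dt`, the integrand `r(t)^d` being
integrable on `(T, ∞)`.  Proof: `e^{-Tε}/ε = ∫_T^∞ e^{-tε} dt` for `ε > 0` and Fubini on
`[-π,π]^d × (T,∞)`, dominated by `∫ dp/ε < ∞`; the case `T = 0` is (A.7),
`latticeGreen_eq_integral_prod_srwHeatKernel`. [cite: SalmhoferSeiler1991, Appendix (A.7)] -/
theorem setIntegral_exp_mul_inv_dispersion_eq (hd : 3 ≤ d) {T : ℝ} (hT : 0 ≤ T) :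
    IntegrableOn (fun t : ℝ => srwHeatKernel t 0 ^ d) (Set.Ioi T) ∧
      ((2 * π) ^ d)⁻¹ * ∫ p in brillouin d, Real.exp (-(T * dispersion p)) / dispersion p =
        ∫ t in Set.Ioi T, srwHeatKernel t 0 ^ d := by
  have hd0 : 0 < d := by omega
  set μ : Measure (Fin d → ℝ) := volume.restrict (brillouin d) with hμ
  set ν : Measure ℝ := volume.restrict (Set.Ioi T) with hν
  set G : (Fin d → ℝ) × ℝ → ℝ := fun q => Real.exp (-(q.2 * dispersion q.1)) with hG
  have hεc : Continuous (dispersion : (Fin d → ℝ) → ℝ) := continuous_dispersion d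
  have hG_cont : Continuous G :=
    Real.continuous_exp.comp ((continuous_snd.mul (hεc.comp continuous_fst)).neg)
  have hG_meas : AEStronglyMeasurable G (μ.prod ν) := hG_cont.aestronglyMeasurable
  have hB : MeasurableSet (brillouin d) := measurableSet_brillouin d
  have hε_pos : ∀ᵐ p ∂μ, 0 < dispersion p := ae_dispersion_pos hd0
  -- the `t`-integrals for fixed `p`
  have hGp : ∀ p, 0 < dispersion p →
      Integrable (fun t => G (p, t)) ν ∧
        ∫ t, G (p, t) ∂ν = Real.exp (-(T * dispersion p)) / dispersion p :=
    fun p hp => integral_exp_neg_mul_Ioi_of_pos hp T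
  -- integrability on the product: the absolute double integral is `≤ ∫ dp/ε`
  have hinv : IntegrableOn (fun p : Fin d → ℝ => (dispersion p)⁻¹) (brillouin d) := by
    have h := (integrable_indicator_iff hB).1 (integrable_indicator_inv_dispersion d hd)
    exact h.congr (Eventually.of_forall fun p => one_div _)
  have hcontT : Continuous fun p : Fin d → ℝ => Real.exp (-(T * dispersion p)) :=
    Real.continuous_exp.comp ((continuous_const.mul hεc).neg)
  have hinner_int : Integrable (fun p => Real.exp (-(T * dispersion p)) / dispersion p) μ := by
    refine hinv.mono' (hcontT.measurable.div hεc.measurable).aestronglyMeasurable ?_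
    filter_upwards [hε_pos] with p hp
    rw [Real.norm_eq_abs, abs_of_nonneg (div_nonneg (Real.exp_pos _).le hp.le), div_eq_mul_inv]
    refine mul_le_of_le_one_left (inv_nonneg.2 hp.le) ?_
    rw [Real.exp_le_one_iff]
    nlinarith
  have hGint : Integrable G (μ.prod ν) := by
    rw [integrable_prod_iff hG_meas]
    refine ⟨?_, ?_⟩
    · filter_upwards [hε_pos] with p hp using (hGp p hp).1
    · refine hinner_int.congr ?_
      filter_upwards [hε_pos] with p hp
      rw [← (hGp p hp).2]
      refine integral_congr_ae (Eventually.of_forall fun t => ?_)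
      simp only [hG, Real.norm_eq_abs, Real.abs_exp]
  -- the inner `p`-integral for fixed `t`
  have hinner : ∀ t : ℝ, ∫ p, G (p, t) ∂μ = (2 * π) ^ d * srwHeatKernel t 0 ^ d := fun t => by
    simp only [hG, hμ]
    exact setIntegral_exp_neg_mul_dispersion t
  have h2π : (0 : ℝ) < (2 * π) ^ d := by positivity
  refine ⟨?_, ?_⟩
  · have h := hGint.integral_prod_right
    have h' : Integrable (fun t => ((2 * π) ^ d)⁻¹ * ∫ p, G (p, t) ∂μ) ν := h.const_mul _
    refine h'.congr (Eventually.of_forall fun t => ?_)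
    simp only [hinner]
    field_simp
  · have h1 : ∫ p in brillouin d, Real.exp (-(T * dispersion p)) / dispersion p =
        ∫ p, ∫ t, G (p, t) ∂ν ∂μ := by
      refine integral_congr_ae ?_
      filter_upwards [hε_pos] with p hp
      rw [(hGp p hp).2]
    rw [h1, integral_integral_swap hGint]
    simp_rw [hinner]
    rw [integral_const_mul]
    field_simp

/-- The integrand `e^{-Tε}/ε` of the time-shifted representation is integrable on the Brillouin
zone (`d ≥ 3`, `T ≥ 0`). [folklore] -/
private theorem integrableOn_exp_mul_inv_dispersion (hd : 3 ≤ d) {T : ℝ} (hT : 0 ≤ T) :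
    IntegrableOn (fun p : Fin d → ℝ => Real.exp (-(T * dispersion p)) / dispersion p)
      (brillouin d) := by
  have hd0 : 0 < d := by omega
  have hεc : Continuous (dispersion : (Fin d → ℝ) → ℝ) := continuous_dispersion d
  have hB : MeasurableSet (brillouin d) := measurableSet_brillouin d
  have hinv : IntegrableOn (fun p : Fin d → ℝ => (dispersion p)⁻¹) (brillouin d) := by
    have h := (integrable_indicator_iff hB).1 (integrable_indicator_inv_dispersion d hd)
    exact h.congr (Eventually.of_forall fun p => one_div _)
  have hcontT : Continuous fun p : Fin d → ℝ => Real.exp (-(T * dispersion p)) :=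
    Real.continuous_exp.comp ((continuous_const.mul hεc).neg)
  refine hinv.mono' (hcontT.measurable.div hεc.measurable).aestronglyMeasurable ?_
  filter_upwards [ae_dispersion_pos hd0] with p hp
  rw [Real.norm_eq_abs, abs_of_nonneg (div_nonneg (Real.exp_pos _).le hp.le), div_eq_mul_inv]
  refine mul_le_of_le_one_left (inv_nonneg.2 hp.le) ?_
  rw [Real.exp_le_one_iff]
  nlinarith

/-! ### The antipodal Laplace transform -/

/-- `∫_{-π}^{π} e^{-a(1 + cos k)} dk = ∫_{-π}^{π} e^{-a(1 - cos k)} dk` (shift `k ↦ k + π` and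
`2π`-periodicity). [folklore] -/
private theorem intervalIntegral_exp_neg_mul_one_add_cos (a : ℝ) :
    ∫ k in (-π)..π, Real.exp (-(a * (1 + Real.cos k))) =
      ∫ k in (-π)..π, Real.exp (-(a * (1 - Real.cos k))) := by
  have hper : Function.Periodic (fun k : ℝ => Real.exp (-(a * (1 - Real.cos k)))) (2 * π) := by
    intro k
    simp only [Real.cos_add_two_pi]
  have h1 : (fun k : ℝ => Real.exp (-(a * (1 + Real.cos k)))) =
      fun k => (fun x : ℝ => Real.exp (-(a * (1 - Real.cos x)))) (k + π) := by
    funext k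
    simp only [Real.cos_add_pi, sub_neg_eq_add]
  rw [h1, intervalIntegral.integral_comp_add_right (fun x : ℝ => Real.exp (-(a * (1 - Real.cos x)))) π]
  have h2 := hper.intervalIntegral_add_eq 0 (-π)
  rw [show -π + π = (0 : ℝ) by ring, show π + π = 0 + 2 * π by ring, h2,
    show -π + 2 * π = π by ring]

/-- **The antipodal Laplace transform**: `∫_{[-π,π]^d} e^{-a Σⱼ (1 + cos pⱼ)} dp = (2π)^d r(a)^d`
(the integrand is `e^{-a·d(1 + φ)}`, concentrated at the antipode `p = (π,…,π)`; product structure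
and the shift `pⱼ ↦ pⱼ + π` in each coordinate). [folklore] -/
private theorem setIntegral_exp_neg_mul_sum_one_add_cos (a : ℝ) :
    ∫ p in brillouin d, Real.exp (-(a * ∑ j, (1 + Real.cos (p j)))) =
      (2 * π) ^ d * srwHeatKernel a 0 ^ d := by
  have hprod : ∀ p : Fin d → ℝ, Real.exp (-(a * ∑ j, (1 + Real.cos (p j)))) =
      ∏ j, Real.exp (-(a * (1 + Real.cos (p j)))) := fun p => by
    rw [← Real.exp_sum, Finset.mul_sum, ← Finset.sum_neg_distrib]
  simp_rw [hprod]
  rw [volume_restrict_brillouin d,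
    integral_fintype_prod_eq_pow (f := fun k : ℝ => Real.exp (-(a * (1 + Real.cos k))))]
  have hle : (-π : ℝ) ≤ π := by linarith [Real.pi_pos]
  have h1 : ∫ k in Set.Icc (-π) π, Real.exp (-(a * (1 + Real.cos k))) = 2 * π * srwHeatKernel a 0 := by
    rw [integral_Icc_eq_integral_Ioc, ← intervalIntegral.integral_of_le hle,
      intervalIntegral_exp_neg_mul_one_add_cos, srwHeatKernel_zero_eq]
    field_simp
  rw [Fintype.card_fin, h1, mul_pow]

/-! ### The remainder bound -/

/-- `y^K ≤ e^{-K(1-y)}` for `0 ≤ y ≤ 1`? Only `0 ≤ y` is needed: `y ≤ e^{y-1}`. [folklore] -/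
private theorem pow_le_exp_neg_mul_one_sub {y : ℝ} (hy : 0 ≤ y) (K : ℕ) :
    y ^ K ≤ Real.exp (-(K * (1 - y))) := by
  have h : y ≤ Real.exp (y - 1) := by linarith [Real.add_one_le_exp (y - 1)]
  calc y ^ K ≤ Real.exp (y - 1) ^ K := pow_le_pow_left₀ hy h K
    _ = Real.exp (-(K * (1 - y))) := by rw [← Real.exp_nat_mul]; ring_nf

/-- **Pointwise majorant of the geometric remainder**: for `x < 1` and every `K`,
`x^K/(1-x) ≤ e^{-K(1-x)}/(1-x) + e^{-K(1+x)}` (for `x ≥ 0` the first term dominates since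
`x ≤ e^{x-1}`; for `x < 0`, `1/(1-x) ≤ 1` and `|x|^K ≤ e^{-K(1-|x|)}`). [folklore] -/
private theorem pow_mul_inv_one_sub_le {x : ℝ} (hx1 : x < 1) (K : ℕ) :
    x ^ K * (1 - x)⁻¹ ≤
      Real.exp (-(K * (1 - x))) * (1 - x)⁻¹ + Real.exp (-(K * (1 + x))) := by
  have h1x : 0 < 1 - x := by linarith
  have hA : 0 ≤ Real.exp (-(K * (1 - x))) * (1 - x)⁻¹ := by positivity
  have hB : 0 ≤ Real.exp (-(K * (1 + x))) := (Real.exp_pos _).le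
  rcases le_or_gt 0 x with hx | hx
  · have h2 : x ^ K * (1 - x)⁻¹ ≤ Real.exp (-(K * (1 - x))) * (1 - x)⁻¹ :=
      mul_le_mul_of_nonneg_right (pow_le_exp_neg_mul_one_sub hx K) (inv_nonneg.2 h1x.le)
    linarith
  · have h3 : x ^ K * (1 - x)⁻¹ ≤ |x| ^ K := by
      have hinv1 : (1 - x)⁻¹ ≤ 1 := inv_le_one_of_one_le₀ (by linarith)
      calc x ^ K * (1 - x)⁻¹ ≤ |x ^ K * (1 - x)⁻¹| := le_abs_self _
        _ = |x| ^ K * (1 - x)⁻¹ := by rw [abs_mul, abs_pow, abs_of_pos (inv_pos.2 h1x)]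
        _ ≤ |x| ^ K * 1 := by gcongr
        _ = |x| ^ K := mul_one _
    have h4 := pow_le_exp_neg_mul_one_sub (abs_nonneg x) K
    rw [abs_of_neg hx, sub_neg_eq_add] at h4
    rw [abs_of_neg hx] at h3
    linarith

/-- The matching lower bound: `-e^{-K(1+x)} ≤ x^K/(1-x)` for `x < 1`. [folklore] -/
private theorem neg_exp_le_pow_mul_inv_one_sub {x : ℝ} (hx1 : x < 1) (K : ℕ) :
    -Real.exp (-(K * (1 + x))) ≤ x ^ K * (1 - x)⁻¹ := by
  have h1x : 0 < 1 - x := by linarith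
  rcases le_or_gt 0 x with hx | hx
  · have : 0 ≤ x ^ K * (1 - x)⁻¹ := by positivity
    linarith [Real.exp_pos (-(K * (1 + x)))]
  · have h3 : -(|x| ^ K) ≤ x ^ K * (1 - x)⁻¹ := by
      have hinv1 : (1 - x)⁻¹ ≤ 1 := inv_le_one_of_one_le₀ (by linarith)
      have : |x ^ K * (1 - x)⁻¹| ≤ |x| ^ K := by
        calc |x ^ K * (1 - x)⁻¹| = |x| ^ K * (1 - x)⁻¹ := by
              rw [abs_mul, abs_pow, abs_of_pos (inv_pos.2 h1x)]
          _ ≤ |x| ^ K * 1 := by gcongr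
          _ = |x| ^ K := mul_one _
      linarith [neg_abs_le (x ^ K * (1 - x)⁻¹)]
    have h4 := pow_le_exp_neg_mul_one_sub (abs_nonneg x) K
    rw [abs_of_neg hx, sub_neg_eq_add] at h4
    rw [abs_of_neg hx] at h3
    linarith

/-- The pointwise majorant on the Brillouin zone: where `ε(p) > 0`,
`φ^K d/ε ≤ d · e^{-(K/d)ε}/ε + e^{-(K/d) Σⱼ(1 + cos pⱼ)}`. [folklore] -/
private theorem symbolPow_mul_dim_div_dispersion_le (hd : 0 < d) {p : Fin d → ℝ} (hp : 0 < dispersion p) (K : ℕ) :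
    ((d : ℝ)⁻¹ * ∑ j, Real.cos (p j)) ^ K * ((d : ℝ) / dispersion p) ≤
      (d : ℝ) * (Real.exp (-((K : ℝ) / d * dispersion p)) / dispersion p) +
        Real.exp (-((K : ℝ) / d * ∑ j, (1 + Real.cos (p j)))) := by
  have hd' : (0 : ℝ) < d := by exact_mod_cast hd
  have hsub := one_sub_inv_mul_sum_cos hd p
  have hadd := one_add_inv_mul_sum_cos hd p
  have hx1 : (d : ℝ)⁻¹ * ∑ j, Real.cos (p j) < 1 := by
    have : 0 < dispersion p / d := div_pos hp hd'
    linarith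
  have h := pow_mul_inv_one_sub_le hx1 K
  have hinv : (1 - (d : ℝ)⁻¹ * ∑ j, Real.cos (p j))⁻¹ = (d : ℝ) / dispersion p := by rw [hsub, inv_div]
  have hK1 : -((K : ℝ) * (1 - (d : ℝ)⁻¹ * ∑ j, Real.cos (p j))) = -((K : ℝ) / d * dispersion p) := by
    rw [hsub]; field_simp
  have hK2 : -((K : ℝ) * (1 + (d : ℝ)⁻¹ * ∑ j, Real.cos (p j))) = -((K : ℝ) / d * ∑ j, (1 + Real.cos (p j))) := by
    rw [hadd]; field_simp
  rw [hinv, hK1, hK2] at h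
  calc ((d : ℝ)⁻¹ * ∑ j, Real.cos (p j)) ^ K * ((d : ℝ) / dispersion p)
      ≤ Real.exp (-((K : ℝ) / d * dispersion p)) * ((d : ℝ) / dispersion p) +
          Real.exp (-((K : ℝ) / d * ∑ j, (1 + Real.cos (p j)))) := h
    _ = (d : ℝ) * (Real.exp (-((K : ℝ) / d * dispersion p)) / dispersion p) +
          Real.exp (-((K : ℝ) / d * ∑ j, (1 + Real.cos (p j)))) := by ring

/-- … and the pointwise minorant `-e^{-(K/d) Σⱼ(1 + cos pⱼ)} ≤ φ^K d/ε`. [folklore] -/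
private theorem neg_exp_le_symbolPow_mul_dim_div_dispersion (hd : 0 < d) {p : Fin d → ℝ} (hp : 0 < dispersion p) (K : ℕ) :
    -Real.exp (-((K : ℝ) / d * ∑ j, (1 + Real.cos (p j)))) ≤
      ((d : ℝ)⁻¹ * ∑ j, Real.cos (p j)) ^ K * ((d : ℝ) / dispersion p) := by
  have hd' : (0 : ℝ) < d := by exact_mod_cast hd
  have hsub := one_sub_inv_mul_sum_cos hd p
  have hadd := one_add_inv_mul_sum_cos hd p
  have hx1 : (d : ℝ)⁻¹ * ∑ j, Real.cos (p j) < 1 := by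
    have : 0 < dispersion p / d := div_pos hp hd'
    linarith
  have h := neg_exp_le_pow_mul_inv_one_sub hx1 K
  have hinv : (1 - (d : ℝ)⁻¹ * ∑ j, Real.cos (p j))⁻¹ = (d : ℝ) / dispersion p := by rw [hsub, inv_div]
  have hK2 : -((K : ℝ) * (1 + (d : ℝ)⁻¹ * ∑ j, Real.cos (p j))) = -((K : ℝ) / d * ∑ j, (1 + Real.cos (p j))) := by
    rw [hadd]; field_simp
  rwa [hinv, hK2] at h

/-- **Upper bound on the remainder** (`d ≥ 3`, every `K`):
`(2π)^{-d} ∫ φ^K d/ε ≤ d ∫_{K/d}^∞ r(t)^d dt + r(K/d)^d`.  The first term is the genuine tail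
(`≈ Σ_{n ≥ K} P(Sₙ = 0)`: `φ^K ≤ e^{-K(1-φ)}` is sharp at the pole `φ = 1`), the second the
(exponentially small in `K/d`) contribution of the antipode `φ = -1`. [cite: SalmhoferSeiler1991, Appendix (A.7), Lemma A.4 (the majorants `r(t)`), p. 430] -/
theorem remainder_le (hd : 3 ≤ d) (K : ℕ) :
    ((2 * π) ^ d)⁻¹ * ∫ p in brillouin d, ((d : ℝ)⁻¹ * ∑ j, Real.cos (p j)) ^ K * ((d : ℝ) / dispersion p) ≤
      (d : ℝ) * (∫ t in Set.Ioi ((K : ℝ) / d), srwHeatKernel t 0 ^ d) +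
        srwHeatKernel ((K : ℝ) / d) 0 ^ d := by
  have hd0 : 0 < d := by omega
  have hT : (0 : ℝ) ≤ (K : ℝ) / d := by positivity
  have h2π : (0 : ℝ) < (2 * π) ^ d := by positivity
  obtain ⟨-, hrep⟩ := setIntegral_exp_mul_inv_dispersion_eq hd hT
  have hanti := setIntegral_exp_neg_mul_sum_one_add_cos (d := d) ((K : ℝ) / d)
  have hI1 := integrableOn_exp_mul_inv_dispersion hd hT
  have hI2 : IntegrableOn (fun p : Fin d → ℝ =>
      Real.exp (-((K : ℝ) / d * ∑ j, (1 + Real.cos (p j))))) (brillouin d) :=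
    (by fun_prop : Continuous fun p : Fin d → ℝ =>
      Real.exp (-((K : ℝ) / d * ∑ j, (1 + Real.cos (p j))))).continuousOn.integrableOn_compact
      (isCompact_brillouin d)
  have hmono : ∫ p in brillouin d, ((d : ℝ)⁻¹ * ∑ j, Real.cos (p j)) ^ K * ((d : ℝ) / dispersion p) ≤
      ∫ p in brillouin d, ((d : ℝ) * (Real.exp (-((K : ℝ) / d * dispersion p)) / dispersion p) +
        Real.exp (-((K : ℝ) / d * ∑ j, (1 + Real.cos (p j))))) := by
    refine integral_mono_ae (integrableOn_symbolPow_mul_dim_div_dispersion hd K) ((hI1.const_mul _).add hI2) ?_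
    filter_upwards [ae_dispersion_pos hd0] with p hp
    exact symbolPow_mul_dim_div_dispersion_le hd0 hp K
  rw [integral_add (hI1.const_mul _) hI2, integral_const_mul, hanti] at hmono
  calc ((2 * π) ^ d)⁻¹ * ∫ p in brillouin d, ((d : ℝ)⁻¹ * ∑ j, Real.cos (p j)) ^ K * ((d : ℝ) / dispersion p)
      ≤ ((2 * π) ^ d)⁻¹ * ((d : ℝ) * (∫ p in brillouin d,
            Real.exp (-((K : ℝ) / d * dispersion p)) / dispersion p) +
          (2 * π) ^ d * srwHeatKernel ((K : ℝ) / d) 0 ^ d) :=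
        mul_le_mul_of_nonneg_left hmono (inv_nonneg.2 h2π.le)
    _ = (d : ℝ) * (((2 * π) ^ d)⁻¹ * ∫ p in brillouin d,
            Real.exp (-((K : ℝ) / d * dispersion p)) / dispersion p) +
          srwHeatKernel ((K : ℝ) / d) 0 ^ d := by
        field_simp
    _ = (d : ℝ) * (∫ t in Set.Ioi ((K : ℝ) / d), srwHeatKernel t 0 ^ d) +
          srwHeatKernel ((K : ℝ) / d) 0 ^ d := by rw [hrep]

/-- **Lower bound on the remainder**: `-r(K/d)^d ≤ (2π)^{-d} ∫ φ^K d/ε` (for even `K` the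
remainder is in fact `≥ 0`). [folklore] -/
private theorem neg_le_remainder (hd : 3 ≤ d) (K : ℕ) :
    -(srwHeatKernel ((K : ℝ) / d) 0 ^ d) ≤
      ((2 * π) ^ d)⁻¹ * ∫ p in brillouin d, ((d : ℝ)⁻¹ * ∑ j, Real.cos (p j)) ^ K * ((d : ℝ) / dispersion p) := by
  have hd0 : 0 < d := by omega
  have h2π : (0 : ℝ) < (2 * π) ^ d := by positivity
  have hanti := setIntegral_exp_neg_mul_sum_one_add_cos (d := d) ((K : ℝ) / d)
  have hI2 : IntegrableOn (fun p : Fin d → ℝ =>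
      Real.exp (-((K : ℝ) / d * ∑ j, (1 + Real.cos (p j))))) (brillouin d) :=
    (by fun_prop : Continuous fun p : Fin d → ℝ =>
      Real.exp (-((K : ℝ) / d * ∑ j, (1 + Real.cos (p j))))).continuousOn.integrableOn_compact
      (isCompact_brillouin d)
  have hmono : ∫ p in brillouin d, -Real.exp (-((K : ℝ) / d * ∑ j, (1 + Real.cos (p j)))) ≤
      ∫ p in brillouin d, ((d : ℝ)⁻¹ * ∑ j, Real.cos (p j)) ^ K * ((d : ℝ) / dispersion p) := by
    refine integral_mono_ae hI2.neg (integrableOn_symbolPow_mul_dim_div_dispersion hd K) ?_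
    filter_upwards [ae_dispersion_pos hd0] with p hp
    exact neg_exp_le_symbolPow_mul_dim_div_dispersion hd0 hp K
  rw [integral_neg, hanti] at hmono
  calc -(srwHeatKernel ((K : ℝ) / d) 0 ^ d)
      = ((2 * π) ^ d)⁻¹ * (-((2 * π) ^ d * srwHeatKernel ((K : ℝ) / d) 0 ^ d)) := by
        field_simp
    _ ≤ ((2 * π) ^ d)⁻¹ * ∫ p in brillouin d, ((d : ℝ)⁻¹ * ∑ j, Real.cos (p j)) ^ K * ((d : ℝ) / dispersion p) :=
        mul_le_mul_of_nonneg_left hmono (inv_nonneg.2 h2π.le)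

/-- **Two-sided control of the partial sums of the return probabilities** (`d ≥ 3`, every `K`):
`d·G(0) - d∫_{K/d}^∞ r^d - r(K/d)^d ≤ Σ_{n<K} P(Sₙ = 0) ≤ d·G(0) + r(K/d)^d` — the frame in which
the numerical values of `R(ν) = G(0)` used in Prop. 4.2 (4) and on p. 430 ("`R(4) ≤ 0.3100`, …")
are certified from finitely many return probabilities and the majorant of Lemma A.4.
[cite: SalmhoferSeiler1991, Prop. 4.2 (4), Appendix (A.7), Lemma A.4 and p. 430] -/
theorem sum_range_prob_zero_mem_Icc (hd : 3 ≤ d) (K : ℕ) :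
    (d : ℝ) * latticeGreen (0 : Site d) -
        ((d : ℝ) * (∫ t in Set.Ioi ((K : ℝ) / d), srwHeatKernel t 0 ^ d) +
          srwHeatKernel ((K : ℝ) / d) 0 ^ d) ≤ ∑ n ∈ Finset.range K, SRW.prob d n 0 ∧
      ∑ n ∈ Finset.range K, SRW.prob d n 0 ≤
        (d : ℝ) * latticeGreen (0 : Site d) + srwHeatKernel ((K : ℝ) / d) 0 ^ d := by
  have h := dim_mul_latticeGreen_zero_eq_sum_add hd K
  have h1 := remainder_le hd K
  have h2 := neg_le_remainder hd K
  constructor <;> linarith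

/-! ### The series `Σₙ P(Sₙ = 0) = d · latticeGreen 0` -/

/-- `r(t) → 0` as `t → ∞` (from Lemma A.4, `0 ≤ r(t) ≤ (1+2t)^{-1/2}`). [cite: SalmhoferSeiler1991, Lemma A.4 (A.22)] -/
theorem tendsto_srwHeatKernel_zero_atTop : Tendsto (fun t : ℝ => srwHeatKernel t 0) atTop (𝓝 0) := by
  have hup : Tendsto (fun t : ℝ => 1 / Real.sqrt (1 + 2 * t)) atTop (𝓝 0) := by
    have h1 : Tendsto (fun t : ℝ => 1 + 2 * t) atTop atTop :=
      tendsto_atTop_add_const_left _ _ (tendsto_id.const_mul_atTop (by norm_num : (0 : ℝ) < 2))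
    have h2 : Tendsto (fun t : ℝ => Real.sqrt (1 + 2 * t)) atTop atTop :=
      Real.tendsto_sqrt_atTop.comp h1
    have h3 := tendsto_inv_atTop_zero.comp h2
    refine h3.congr fun t => ?_
    simp only [Function.comp_apply, one_div]
  refine tendsto_of_tendsto_of_tendsto_of_le_of_le' tendsto_const_nhds hup
    (Eventually.of_forall fun t => srwHeatKernel_zero_nonneg t) ?_
  filter_upwards [eventually_ge_atTop (0 : ℝ)] with t ht
  exact srwHeatKernel_zero_le_inv_sqrt ht

/-- The tail `∫_T^∞ r(t)^d dt → 0` as `T → ∞` (`d ≥ 3`; the integral over `(0,∞)` converges,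
(A.7)/(A.23)). [folklore] -/
private theorem tendsto_integral_Ioi_srwHeatKernel_zero_pow (hd : 3 ≤ d) :
    Tendsto (fun T : ℝ => ∫ t in Set.Ioi T, srwHeatKernel t 0 ^ d) atTop (𝓝 0) := by
  obtain ⟨hint, -⟩ := setIntegral_exp_mul_inv_dispersion_eq hd le_rfl
  set f : ℝ → ℝ := fun t => srwHeatKernel t 0 ^ d with hf
  have hlim := intervalIntegral_tendsto_integral_Ioi 0 hint tendsto_id
  -- `∫_{Set.Ioi T} f = ∫_{Set.Ioi 0} f - ∫_0^T f` for `T ≥ 0`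
  have hsplit : ∀ T : ℝ, 0 ≤ T →
      ∫ t in Set.Ioi T, f t = (∫ t in Set.Ioi 0, f t) - ∫ t in (0 : ℝ)..T, f t := by
    intro T hT
    have hunion : Set.Ioc 0 T ∪ Set.Ioi T = Set.Ioi 0 := Set.Ioc_union_Ioi_eq_Ioi hT
    have hdisj : Disjoint (Set.Ioc 0 T) (Set.Ioi T) := fun s h1 h2 x hx =>
      (not_lt.2 (h1 hx).2) (h2 hx)
    have h := setIntegral_union hdisj measurableSet_Ioi (hint.mono_set Ioc_subset_Ioi_self)
      (hint.mono_set (Set.Ioi_subset_Ioi hT))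
    rw [hunion] at h
    rw [h, intervalIntegral.integral_of_le hT]
    ring
  have h2 : Tendsto (fun T : ℝ => (∫ t in Set.Ioi 0, f t) - ∫ t in (0 : ℝ)..T, f t) atTop (𝓝 0) := by
    simpa using (tendsto_const_nhds (x := ∫ t in Set.Ioi 0, f t)).sub hlim
  refine h2.congr' ?_
  filter_upwards [eventually_ge_atTop (0 : ℝ)] with T hT
  exact (hsplit T hT).symm

/-- **The Green function at the origin is the expected number of visits**:
`Σₙ P(Sₙ = 0) = d · latticeGreen 0` for `d ≥ 3` (Lawler–Limic 2010, §4.3; here from the finite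
expansion and the remainder bounds, the remainder tending to `0`). [cite: LawlerLimic2010, §4.3] -/
theorem hasSum_prob_zero (hd : 3 ≤ d) :
    HasSum (fun n => SRW.prob d n 0) ((d : ℝ) * latticeGreen (0 : Site d)) := by
  have hd0 : 0 < d := by omega
  have hd' : (0 : ℝ) < d := by exact_mod_cast hd0
  rw [hasSum_iff_tendsto_nat_of_nonneg (fun n => SRW.prob_nonneg n 0)]
  -- the two error terms tend to `0` along `K ↦ K/d`
  have hK : Tendsto (fun K : ℕ => (K : ℝ) / d) atTop atTop :=
    tendsto_natCast_atTop_atTop.atTop_div_const hd'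
  have hA : Tendsto (fun K : ℕ => srwHeatKernel ((K : ℝ) / d) 0 ^ d) atTop (𝓝 0) := by
    have h := (tendsto_srwHeatKernel_zero_atTop.comp hK).pow d
    rwa [zero_pow (by omega : d ≠ 0)] at h
  have hB : Tendsto (fun K : ℕ => (d : ℝ) * ∫ t in Set.Ioi ((K : ℝ) / d), srwHeatKernel t 0 ^ d)
      atTop (𝓝 0) := by
    simpa using ((tendsto_integral_Ioi_srwHeatKernel_zero_pow hd).comp hK).const_mul (d : ℝ)
  set G : ℝ := (d : ℝ) * latticeGreen (0 : Site d) with hG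
  have hlow : Tendsto (fun K : ℕ => G - ((d : ℝ) * (∫ t in Set.Ioi ((K : ℝ) / d), srwHeatKernel t 0 ^ d) +
      srwHeatKernel ((K : ℝ) / d) 0 ^ d)) atTop (𝓝 G) := by
    simpa using (tendsto_const_nhds (x := G)).sub (hB.add hA)
  have hup : Tendsto (fun K : ℕ => G + srwHeatKernel ((K : ℝ) / d) 0 ^ d) atTop (𝓝 G) := by
    simpa using (tendsto_const_nhds (x := G)).add hA
  exact tendsto_of_tendsto_of_tendsto_of_le_of_le hlow hup
    (fun K => (sum_range_prob_zero_mem_Icc hd K).1) (fun K => (sum_range_prob_zero_mem_Icc hd K).2)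

/-- **The glue announced in `SRWReturnFourier.lean`**: the Green function of the simple random walk
on `ℤ⁴` at the origin (expected number of visits, Lawler–Limic 2010, §4.3) is
`SRW.green4 = Σₘ P(Sₘ = 0) = 4 · latticeGreen 0`. [cite: LawlerLimic2010, §4.3] -/
theorem SRW.green4_eq_four_mul_latticeGreen : SRW.green4 = 4 * latticeGreen (0 : Site 4) := by
  have h := (hasSum_prob_zero (d := 4) (by norm_num)).tsum_eq
  rw [SRW.green4, h]
  norm_num

end Literature.Probability.LatticeModels
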